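import Mathlib
import HarnessLib
import Literature.Analysis.FluidPDE.VectorCalculus
import Literature.Analysis.FluidPDE.TaoEnstrophyLocalisation
import Literature.Analysis.FluidPDE.BiotSavartCurlPair
import Summits.NavierStokesRegularity.NavierStokesRegularity.Theorems.UnthreadedDoorNetFluxDefs
import Summits.NavierStokesRegularity.NavierStokesRegularity.Theorems.UnthreadedDoorNetFluxParametricIntegralAnalytic

/-!
# Route `UnthreadedDoor`, crux `PoloidalLiouville` (stmt-NavierStokesRegularity-1222), WALL W1 — «height-head» line:
# `AnalyticNormalisation` — the vortex-sheet potential can be re-gauged to be REAL-ANALYTIC off the centre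

ns-idea-14's crux idea «height-head» (`Cruxes/PoloidalLiouville/HeightHeadSketch.lean` v3.2, l.195–201), the LEMMA
`HeightHead.AnalyticNormalisation`, proved here with its binders VERBATIM (`analyticNormalisation`):

  `v` real-analytic on `ℝ³`, `T ∈ C^∞(ℝ³ ∖ {x₀})`, `curl v = ∇T × (x − x₀)` everywhere
  ⟹ `∃ T'` real-analytic on `ℝ³ ∖ {x₀}` with `∇T' × (x − x₀) = ∇T × (x − x₀)` for `x ≠ x₀`.

PROOF (radial re-gauging by great-circle integrals, as the sketch suggests).  `T' x := T x − T (x₀ + ‖x − x₀‖ • e₀)`: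
the subtracted term is a function of `‖x − x₀‖²` alone, so its gradient is radial and the tangential gradients agree
(`cross_gradient_sub_radial`).  Analyticity: with `y = x − x₀`, `ω = curl v` (analytic: `curl v = curlCLM ∘ Dv`) and
the ANALYTIC tangential gradient `W = (‖y‖²)⁻¹ • (y × ω) = ∇T − (⟪y,∇T⟫/‖y‖²) y` (BAC−CAB), every `C¹` path `γ` on a
sphere `S_r(x₀)` has `T (γ 1) − T (γ 0) = ∫₀¹ ⟪W (γ s), γ' s⟫ ds` (`sub_eq_integral_tangential`; `⟪γ − x₀, γ'⟫ = 0`).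
For a unit vector `σ` and `x` off the antipodal ray (`‖y‖ σ + y ≠ 0`) the normalised chord
`Ψ(s, x) = x₀ + ‖y‖ • N/‖N‖`, `N = ‖y‖ σ + s (y − ‖y‖ σ)` (never `0`: `segment_ne_zero_of_norm_eq`) is a jointly
real-analytic great-circle arc from `x₀ + ‖y‖ σ` to `x`, so `T x − T (x₀ + ‖y‖ σ) = ∫₀¹ F(s, x) ds` with `F` jointly
real-analytic on `[0,1] × {‖y‖ σ + y ≠ 0}`; by the landed parametric-integral lemma
`NetFlux.analyticOnNhd_intervalIntegral_param` (p681656) the difference is real-analytic there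
(`analyticOnNhd_sub_ray`).  Near the antipodal ray of `e₀` switch to `σ₁ = ±e₁`:
`T − T(x₀ + ‖y‖e₀) = [T − T(x₀ + ‖y‖σ₁)] + [that same analytic difference for `σ = e₀` evaluated on the ray
`x₀ + ‖y‖σ₁`]`, a composition of analytic maps.

WHAT THIS IS NOT: a pure real-analytic-geometry lemma; the height-head rungs stay CONDITIONAL on the NS spatial
analyticity FACT (LR16 Thm 9.12); `PoloidalLiouville` (1222), `stub_scalarLiouville`, W1 and NS regularity are OPEN and
not addressed.  `--supports stmt-NavierStokesRegularity-1222 --as helper`.  [folklore]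
-/

noncomputable section

-- the summit and its single sub-problem share the name (CONVENTIONS §1)
set_option linter.dupNamespace false

open Set Function Filter Topology InnerProductSpace MeasureTheory Metric
open scoped RealInnerProductSpace ContDiff

namespace Summit.NavierStokesRegularity.NavierStokesRegularity.Theorems.PoloidalLiouville.NetFlux

open Literature.Analysis Literature.Analysis.FluidPDE

section AnalyticNormalisation

/-! ### 1. Radial summands do not change the tangential gradient -/

/-- Subtracting a function of `‖x − x₀‖²` does not change `∇(·)(x) × (x − x₀)`: the gradient of
`x ↦ c (‖x − x₀‖²)` is the radial vector `2 c'(‖x − x₀‖²) (x − x₀)`. [folklore] -/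
theorem cross_gradient_sub_radial {f : E3 → ℝ} {c : ℝ → ℝ} {x₀ x : E3}
    (hf : DifferentiableAt ℝ f x) (hc : DifferentiableAt ℝ c (‖x - x₀‖ ^ 2)) :
    cross (gradient (fun z => f z - c (‖z - x₀‖ ^ 2)) x) (x - x₀) = cross (gradient f x) (x - x₀) := by
  have hn : HasFDerivAt (fun z : E3 => ‖z - x₀‖ ^ 2)
      (2 • (innerSL ℝ (x - x₀)).comp (ContinuousLinearMap.id ℝ E3)) x :=
    ((hasFDerivAt_id x).sub_const x₀).norm_sq
  have hR : HasFDerivAt (fun z : E3 => c (‖z - x₀‖ ^ 2))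
      (deriv c (‖x - x₀‖ ^ 2) • (2 • (innerSL ℝ (x - x₀)).comp (ContinuousLinearMap.id ℝ E3))) x :=
    hc.hasDerivAt.comp_hasFDerivAt x hn
  set k : ℝ := deriv c (‖x - x₀‖ ^ 2) with hk
  have hL : k • (2 • (innerSL ℝ (x - x₀)).comp (ContinuousLinearMap.id ℝ E3))
      = toDual ℝ E3 ((2 * k) • (x - x₀)) := by
    ext w
    simp
    ring
  have hf' : HasFDerivAt f (toDual ℝ E3 (gradient f x)) x :=
    hasGradientAt_iff_hasFDerivAt.1 hf.hasGradientAt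
  have hD : HasFDerivAt (fun z => f z - c (‖z - x₀‖ ^ 2))
      (toDual ℝ E3 (gradient f x - (2 * k) • (x - x₀))) x := by
    rw [map_sub, ← hL]
    exact hf'.sub hR
  have hG : gradient (fun z => f z - c (‖z - x₀‖ ^ 2)) x = gradient f x - (2 * k) • (x - x₀) :=
    (hasGradientAt_iff_hasFDerivAt.2 hD).gradient
  rw [hG]
  have h2 : cross (x - x₀) (x - x₀) = 0 := by simp [cross]
  have h3 : ∀ (a b c : E3) (t : ℝ), cross (a - t • b) c = cross a c - t • cross b c := by
    intro a b c t
    rw [← crossCLM_apply, ← crossCLM_apply a c, ← crossCLM_apply b c, map_sub, map_smul]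
    rfl
  rw [h3, h2, smul_zero, sub_zero]

/-! ### 2. The tangential gradient is analytic and integrates `T` along sphere paths -/

/-- A convex combination of two vectors of equal norm that are not antipodal never vanishes:
`‖u‖ = ‖w‖`, `u + w ≠ 0` ⟹ `u + s (w − u) ≠ 0` for every real `s` (pair with `u + w`). [folklore] -/
theorem segment_ne_zero_of_norm_eq {u w : E3} (huw : ‖u‖ = ‖w‖) (hne : u + w ≠ 0) (s : ℝ) :
    u + s • (w - u) ≠ 0 := by
  intro h0
  have e1 : ⟪w - u, u + w⟫ = ‖w‖ ^ 2 - ‖u‖ ^ 2 := by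
    rw [inner_sub_left, inner_add_right, inner_add_right, real_inner_self_eq_norm_sq,
      real_inner_self_eq_norm_sq, real_inner_comm u w]
    ring
  have h1 : ⟪u + s • (w - u), u + w⟫ = ‖u‖ ^ 2 + ⟪u, w⟫ := by
    rw [inner_add_left, real_inner_smul_left, e1, inner_add_right, real_inner_self_eq_norm_sq, huw]
    ring
  have h2 : ‖u + w‖ ^ 2 = 2 * (‖u‖ ^ 2 + ⟪u, w⟫) := by
    rw [norm_add_sq_real, huw]; ring
  have h3 : 0 < ‖u + w‖ ^ 2 := pow_pos (norm_pos_iff.2 hne) 2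
  rw [h0, inner_zero_left] at h1
  nlinarith

/-- The curl of a real-analytic field is real-analytic (`curl v = curlCLM ∘ Dv`). [folklore] -/
theorem contDiff_curl_omega {v : E3 → E3} (hv : AnalyticOnNhd ℝ v univ) : ContDiff ℝ ω (curl v) := by
  have h1 : ContDiff ℝ ω v := hv.contDiff
  have h2 : ContDiff ℝ ω (fderiv ℝ v) := h1.fderiv_right le_top
  have h3 : curl v = fun u => curlCLM (fderiv ℝ v u) := rfl
  rw [h3]
  exact curlCLM.contDiff.comp h2

/-- The ANALYTIC TANGENTIAL GRADIENT `W x = (‖x − x₀‖²)⁻¹ • ((x − x₀) × curl v x)` is real-analytic off `x₀`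
for real-analytic `v`. [folklore] -/
theorem contDiffAt_tangentialField {v : E3 → E3} (hv : AnalyticOnNhd ℝ v univ) (x₀ : E3) {u : E3}
    (hu : u ≠ x₀) :
    ContDiffAt ℝ ω (fun x : E3 => (‖x - x₀‖ ^ 2)⁻¹ • cross (x - x₀) (curl v x)) u := by
  have h1 : ContDiffAt ℝ ω (fun x : E3 => (‖x - x₀‖ ^ 2)⁻¹) u := by
    refine ((contDiffAt_id.sub contDiffAt_const).norm_sq ℝ).inv ?_
    exact pow_ne_zero 2 (norm_ne_zero_iff.2 (sub_ne_zero.2 hu))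
  have h2 : ContDiffAt ℝ ω (fun x : E3 => crossCLM (x - x₀)) u :=
    (crossCLM.contDiff.comp (contDiff_id.sub contDiff_const)).contDiffAt
  have h3 : ContDiffAt ℝ ω (curl v) u := (contDiff_curl_omega hv).contDiffAt
  have h4 : ContDiffAt ℝ ω (fun x : E3 => crossCLM (x - x₀) (curl v x)) u := h2.clm_apply h3
  exact h1.smul h4

/-- **Line integral of the tangential gradient along a sphere path.**  `T ∈ C¹(ℝ³ ∖ {x₀})`,
`curl v = ∇T × (x − x₀)`; `γ` a `C¹` path with `‖γ s − x₀‖ = ρ > 0` for all `s`.  Then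
`T (γ 1) − T (γ 0) = ∫₀¹ ⟪W (γ s), γ' s⟫ ds` with `W = (‖y‖²)⁻¹ • (y × curl v)`: indeed `⟪γ − x₀, γ'⟫ = 0` and
`W = ∇T − (⟪y, ∇T⟫/‖y‖²) y` by BAC−CAB. [folklore] -/
theorem sub_eq_integral_tangential {v : E3 → E3} {T : E3 → ℝ} {x₀ : E3}
    (hT : ContDiffOn ℝ 1 T ({x₀}ᶜ : Set E3)) (hω : ∀ x, curl v x = cross (gradient T x) (x - x₀))
    {γ γ' : ℝ → E3} {ρ : ℝ} (hρ : 0 < ρ) (hγs : ∀ s, ‖γ s - x₀‖ = ρ)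
    (hγd : ∀ s, HasDerivAt γ (γ' s) s) (hγ'c : Continuous γ') :
    T (γ 1) - T (γ 0) =
      ∫ s in (0 : ℝ)..1, ⟪(‖γ s - x₀‖ ^ 2)⁻¹ • cross (γ s - x₀) (curl v (γ s)), γ' s⟫ := by
  have hne : ∀ s, γ s ≠ x₀ := fun s h => by
    have := hγs s
    rw [h, sub_self, norm_zero] at this
    exact hρ.ne this
  have hTd : ∀ s, HasFDerivAt T (fderiv ℝ T (γ s)) (γ s) := fun s =>
    ((hT.differentiableOn one_ne_zero).differentiableAt
      (isOpen_compl_singleton.mem_nhds (hne s))).hasFDerivAt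
  have hg : ∀ s, HasDerivAt (fun t => T (γ t)) (fderiv ℝ T (γ s) (γ' s)) s := fun s =>
    (hTd s).comp_hasDerivAt s (hγd s)
  -- the velocity is tangent to the sphere
  have horth : ∀ s, ⟪γ s - x₀, γ' s⟫ = 0 := by
    intro s
    have h1 : HasDerivAt (fun t => ⟪γ t - x₀, γ t - x₀⟫)
        (⟪γ s - x₀, γ' s⟫ + ⟪γ' s, γ s - x₀⟫) s :=
      ((hγd s).sub_const x₀).inner ℝ ((hγd s).sub_const x₀)
    have h2 : (fun t => ⟪γ t - x₀, γ t - x₀⟫) = fun _ => ρ ^ 2 := by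
      funext t
      rw [real_inner_self_eq_norm_sq, hγs t]
    rw [h2] at h1
    have h3 := h1.unique (hasDerivAt_const s (ρ ^ 2))
    rw [real_inner_comm (γ' s) (γ s - x₀)] at h3
    have h4 : ⟪γ' s, γ s - x₀⟫ = 0 := by linarith
    rwa [real_inner_comm (γ s - x₀) (γ' s)] at h4
  -- the integrand is `d/ds T(γ s)`
  have hpt : ∀ s, fderiv ℝ T (γ s) (γ' s) =
      ⟪(‖γ s - x₀‖ ^ 2)⁻¹ • cross (γ s - x₀) (curl v (γ s)), γ' s⟫ := by
    intro s
    have hn0 : ‖γ s - x₀‖ ^ 2 ≠ 0 := pow_ne_zero 2 (norm_ne_zero_iff.2 (sub_ne_zero.2 (hne s)))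
    rw [← FluidPDE.inner_gradient_left, hω, cross_cross_right, real_inner_self_eq_norm_sq, smul_sub, smul_smul,
      inv_mul_cancel₀ hn0, one_smul, smul_smul, inner_sub_left, real_inner_smul_left, horth, mul_zero,
      sub_zero]
  -- continuity of the integrand and the fundamental theorem of calculus
  have hγc : Continuous γ := continuous_iff_continuousAt.2 fun s => (hγd s).continuousAt
  have hcont : Continuous fun s => fderiv ℝ T (γ s) (γ' s) := by
    have h1 : Continuous fun s => fderiv ℝ T (γ s) :=
      (hT.continuousOn_fderiv_of_isOpen isOpen_compl_singleton le_rfl).comp_continuous hγc hne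
    exact h1.clm_apply hγ'c
  have hftc := intervalIntegral.integral_eq_sub_of_hasDerivAt (a := (0 : ℝ)) (b := 1)
    (f := fun t => T (γ t)) (f' := fun s => fderiv ℝ T (γ s) (γ' s)) (fun s _ => hg s)
    (hcont.intervalIntegrable _ _)
  rw [← hftc]
  exact intervalIntegral.integral_congr fun s _ => hpt s

/-! ### 3. The difference `T x − T (x₀ + ‖x − x₀‖ σ)` is real-analytic off the antipodal ray -/

/-- **Great-circle re-gauging.**  `v` real-analytic, `T ∈ C¹(ℝ³ ∖ {x₀})`, `curl v = ∇T × (x − x₀)`, `σ` a unit vector.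
Then `x ↦ T x − T (x₀ + ‖x − x₀‖ • σ)` is real-analytic on the open set `{‖x − x₀‖ • σ + (x − x₀) ≠ 0}` (the complement
of the closed ray antipodal to `σ`): it is the parametric integral of the analytic tangential field along the
normalised-chord great-circle arc from `x₀ + ‖y‖ σ` to `x`, a jointly real-analytic integrand, so
`analyticOnNhd_intervalIntegral_param` applies. [folklore] -/
theorem analyticOnNhd_sub_ray {v : E3 → E3} {T : E3 → ℝ} {x₀ σ : E3} (hv : AnalyticOnNhd ℝ v univ)
    (hT : ContDiffOn ℝ 1 T ({x₀}ᶜ : Set E3)) (hω : ∀ x, curl v x = cross (gradient T x) (x - x₀))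
    (hσ : ‖σ‖ = 1) :
    AnalyticOnNhd ℝ (fun x => T x - T (x₀ + ‖x - x₀‖ • σ)) {x : E3 | ‖x - x₀‖ • σ + (x - x₀) ≠ 0} := by
  set Ω : Set E3 := {x : E3 | ‖x - x₀‖ • σ + (x - x₀) ≠ 0} with hΩ
  have hΩo : IsOpen Ω := isOpen_ne_fun (by fun_prop) continuous_const
  have hy0 : ∀ x ∈ Ω, x - x₀ ≠ 0 := by
    intro x hx h0
    apply hx
    simp [h0]
  have hx0 : ∀ x ∈ Ω, x ≠ x₀ := fun x hx h => hy0 x hx (sub_eq_zero.2 h)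
  have hnu : ∀ x : E3, ‖‖x - x₀‖ • σ‖ = ‖x - x₀‖ := fun x => by
    rw [norm_smul, norm_norm, hσ, mul_one]
  -- the interpolating chord and its normalisation
  set N : ℝ × E3 → E3 := fun z => ‖z.2 - x₀‖ • σ + z.1 • ((z.2 - x₀) - ‖z.2 - x₀‖ • σ) with hN
  set Ψ : ℝ × E3 → E3 := fun z => x₀ + (‖z.2 - x₀‖ * ‖N z‖⁻¹) • N z with hΨ
  have hN0 : ∀ (s : ℝ), ∀ x ∈ Ω, N (s, x) ≠ 0 := fun s x hx =>
    segment_ne_zero_of_norm_eq (hnu x) hx s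
  have hΨsph : ∀ (s : ℝ), ∀ x ∈ Ω, ‖Ψ (s, x) - x₀‖ = ‖x - x₀‖ := by
    intro s x hx
    simp only [hΨ, add_sub_cancel_left, norm_smul, norm_mul, norm_norm, norm_inv]
    rw [mul_assoc, inv_mul_cancel₀ (norm_ne_zero_iff.2 (hN0 s x hx)), mul_one]
  have hΨ0 : ∀ x ∈ Ω, Ψ (0, x) = x₀ + ‖x - x₀‖ • σ := by
    intro x hx
    have h1 : N (0, x) = ‖x - x₀‖ • σ := by simp [hN]
    simp only [hΨ, h1, hnu]
    rw [mul_inv_cancel₀ (norm_ne_zero_iff.2 (hy0 x hx)), one_smul]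
  have hΨ1 : ∀ x ∈ Ω, Ψ (1, x) = x := by
    intro x hx
    have h1 : N (1, x) = x - x₀ := by simp [hN]
    simp only [hΨ, h1]
    rw [mul_inv_cancel₀ (norm_ne_zero_iff.2 (hy0 x hx)), one_smul, add_sub_cancel]
  -- joint real-analyticity of the chord family
  have hΨc : ∀ (s : ℝ), ∀ x ∈ Ω, ContDiffAt ℝ ω Ψ (s, x) := by
    intro s x hx
    have hy : ContDiffAt ℝ ω (fun z : ℝ × E3 => z.2 - x₀) (s, x) := contDiffAt_snd.sub contDiffAt_const
    have hn : ContDiffAt ℝ ω (fun z : ℝ × E3 => ‖z.2 - x₀‖) (s, x) := hy.norm ℝ (hy0 x hx)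
    have hNc : ContDiffAt ℝ ω N (s, x) :=
      (hn.smul contDiffAt_const).add (contDiffAt_fst.smul (hy.sub (hn.smul contDiffAt_const)))
    have hNn : ContDiffAt ℝ ω (fun z => ‖N z‖⁻¹) (s, x) :=
      (hNc.norm ℝ (hN0 s x hx)).inv (norm_ne_zero_iff.2 (hN0 s x hx))
    exact contDiffAt_const.add ((hn.mul hNn).smul hNc)
  -- the analytic tangential field and the integrand
  set W : E3 → E3 := fun u => (‖u - x₀‖ ^ 2)⁻¹ • cross (u - x₀) (curl v u) with hW
  set Fi : ℝ → E3 → ℝ := fun s x => ⟪W (Ψ (s, x)), fderiv ℝ Ψ (s, x) (1, 0)⟫ with hFi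
  have hFa : ∀ s ∈ uIcc (0 : ℝ) 1, ∀ x ∈ Ω, AnalyticAt ℝ (fun z : ℝ × E3 => Fi z.1 z.2) (s, x) := by
    intro s _ x hx
    have h1 : ContDiffAt ℝ ω (fun z : ℝ × E3 => W (Ψ z)) (s, x) := by
      have hP : Ψ (s, x) ≠ x₀ := by
        intro h
        have := hΨsph s x hx
        rw [h, sub_self, norm_zero] at this
        exact hy0 x hx (norm_eq_zero.1 this.symm)
      exact (contDiffAt_tangentialField hv x₀ hP).comp (s, x) (hΨc s x hx)
    have h2 : ContDiffAt ℝ ω (fun z : ℝ × E3 => fderiv ℝ Ψ z ((1 : ℝ), (0 : E3))) (s, x) :=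
      ((hΨc s x hx).fderiv_right le_top).clm_apply contDiffAt_const
    have h3 : ContDiffAt ℝ ω (fun z : ℝ × E3 => ⟪W (Ψ z), fderiv ℝ Ψ z ((1 : ℝ), (0 : E3))⟫) (s, x) :=
      h1.inner ℝ h2
    have h4 : (fun z : ℝ × E3 => Fi z.1 z.2) =
        fun z : ℝ × E3 => ⟪W (Ψ z), fderiv ℝ Ψ z ((1 : ℝ), (0 : E3))⟫ := by
      funext z
      simp only [hFi, Prod.mk.eta]
    rw [h4]
    exact h3.analyticAt
  have hI : AnalyticOnNhd ℝ (fun x => ∫ s in (0 : ℝ)..1, Fi s x) Ω :=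
    analyticOnNhd_intervalIntegral_param hΩo hFa
  -- identification with the re-gauged potential on `Ω`
  intro x hx
  refine (hI x hx).congr (eventuallyEq_of_mem (hΩo.mem_nhds hx) fun x' hx' => ?_)
  have hd : ∀ s, HasDerivAt (fun t : ℝ => Ψ (t, x')) (fderiv ℝ Ψ (s, x') ((1 : ℝ), (0 : E3))) s := by
    intro s
    have h1 : HasFDerivAt Ψ (fderiv ℝ Ψ (s, x')) (s, x') :=
      ((hΨc s x' hx').differentiableAt (by simp)).hasFDerivAt
    have h2 : HasDerivAt (fun t : ℝ => ((t, x') : ℝ × E3)) ((1 : ℝ), (0 : E3)) s :=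
      (hasDerivAt_id s).prodMk (hasDerivAt_const s x')
    exact h1.comp_hasDerivAt s h2
  have hc' : Continuous fun s : ℝ => fderiv ℝ Ψ (s, x') ((1 : ℝ), (0 : E3)) := by
    refine continuous_iff_continuousAt.2 fun s => ?_
    have h1 : ContinuousAt (fderiv ℝ Ψ) (s, x') :=
      ((hΨc s x' hx').fderiv_right (m := ω) le_top).continuousAt
    have h2 : ContinuousAt (fun t : ℝ => ((t, x') : ℝ × E3)) s := by fun_prop
    exact ((ContinuousAt.comp (f := fun t : ℝ => ((t, x') : ℝ × E3)) h1 h2).clm_apply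
      continuousAt_const)
  have key := sub_eq_integral_tangential hT hω (γ := fun t => Ψ (t, x'))
    (γ' := fun s => fderiv ℝ Ψ (s, x') ((1 : ℝ), (0 : E3))) (norm_pos_iff.2 (hy0 x' hx'))
    (fun s => hΨsph s x' hx') hd hc'
  simp only [hΨ1 x' hx', hΨ0 x' hx'] at key
  simpa [hFi, hW] using key.symm

/-! ### 4. `AnalyticNormalisation` -/

/-- **`HeightHead.AnalyticNormalisation` (ns-idea-14 crux idea «height-head», sketch v3.2 l.195–201), binders VERBATIM.**
For `v` real-analytic on `ℝ³`, `T` smooth off `x₀` with `curl v = ∇T × (x − x₀)`, there is `T'` REAL-ANALYTIC off `x₀`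
with the same tangential gradient `∇T' × (x − x₀) = ∇T × (x − x₀)` (`x ≠ x₀`).  `T' x = T x − T (x₀ + ‖x − x₀‖ • e₀)`
(radial re-gauging); analyticity by `analyticOnNhd_sub_ray` for `σ = e₀`, and near the antipodal ray of `e₀` by the
switch `σ₁ = ±e₁`: `T' = [T − T(x₀ + ‖y‖σ₁)] + (T − T(x₀ + ‖y‖e₀)) ∘ (x ↦ x₀ + ‖x − x₀‖σ₁)`. [folklore] -/
theorem analyticNormalisation :
    ∀ (v : E3 → E3) (x₀ : E3) (T : E3 → ℝ), AnalyticOnNhd ℝ v (univ : Set E3) →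
    ContDiffOn ℝ (⊤ : ℕ∞) T ({x₀}ᶜ : Set E3) →
    (∀ x, curl v x = cross (gradient T x) (x - x₀)) →
    ∃ T' : E3 → ℝ, AnalyticOnNhd ℝ T' ({x₀}ᶜ : Set E3) ∧
      ∀ x, x ≠ x₀ → cross (gradient T' x) (x - x₀) = cross (gradient T x) (x - x₀) := by
  intro v x₀ T hv hT hω
  have hT1 : ContDiffOn ℝ 1 T ({x₀}ᶜ : Set E3) := hT.of_le (by exact_mod_cast le_top)
  -- base directions
  set e₀ : E3 := EuclideanSpace.single 0 1 with he₀
  set e₁ : E3 := EuclideanSpace.single 1 1 with he₁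
  have hne₀ : ‖e₀‖ = 1 := by simp [he₀]
  have hne₁ : ‖e₁‖ = 1 := by simp [he₁]
  have hne₁' : ‖-e₁‖ = 1 := by rw [norm_neg, hne₁]
  have hsum : ∀ τ : ℝ, e₀ + τ • e₁ ≠ 0 := by
    intro τ h
    have := congrArg (fun w : E3 => w 0) h
    simp [he₀, he₁] at this
  refine ⟨fun x => T x - T (x₀ + ‖x - x₀‖ • e₀), ?_, ?_⟩
  · -- analyticity off `x₀`
    intro x₁ hx₁
    have hy₁ : x₁ - x₀ ≠ 0 := sub_ne_zero.2 hx₁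
    have hn₁ : ‖x₁ - x₀‖ ≠ 0 := norm_ne_zero_iff.2 hy₁
    -- choose `σ₁ = ± e₁` off whose antipodal ray `x₁` lies
    obtain ⟨σ₁, hσ₁, hΩ₁, hτ⟩ : ∃ σ₁ : E3, ‖σ₁‖ = 1 ∧ ‖x₁ - x₀‖ • σ₁ + (x₁ - x₀) ≠ 0 ∧
        ∃ τ : ℝ, σ₁ = τ • e₁ := by
      by_cases h : ‖x₁ - x₀‖ • e₁ + (x₁ - x₀) = 0
      · refine ⟨-e₁, hne₁', fun h' => hy₁ ?_, -1, by simp⟩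
        have h2 : (2 : ℝ) • (x₁ - x₀) = 0 := by
          rw [two_smul]
          have := congrArg₂ (· + ·) h h'
          simp only [smul_neg, add_zero] at this
          rw [← this]; abel
        exact (smul_eq_zero.1 h2).resolve_left two_ne_zero
      · exact ⟨e₁, hne₁, h, 1, by simp⟩
    obtain ⟨τ, rfl⟩ := hτ
    -- the ray point `x₀ + ‖y₁‖ σ₁` lies off the antipodal ray of `e₀`
    set p₁ : E3 := x₀ + ‖x₁ - x₀‖ • (τ • e₁) with hp₁
    have hp₁Ω : ‖p₁ - x₀‖ • e₀ + (p₁ - x₀) ≠ 0 := by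
      have h1 : p₁ - x₀ = ‖x₁ - x₀‖ • (τ • e₁) := by simp [hp₁]
      rw [h1, norm_smul, norm_norm, hσ₁, mul_one, ← smul_add]
      exact smul_ne_zero hn₁ (hsum τ)
    -- the three analytic pieces
    have hA := analyticOnNhd_sub_ray hv hT1 hω hσ₁ x₁ hΩ₁
    have hB := analyticOnNhd_sub_ray hv hT1 hω hne₀ p₁ hp₁Ω
    have hC : AnalyticAt ℝ (fun x : E3 => x₀ + ‖x - x₀‖ • (τ • e₁)) x₁ :=
      (contDiffAt_const.add (((contDiffAt_id.sub contDiffAt_const).norm ℝ hy₁).smul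
        contDiffAt_const)).analyticAt
    have hBC := AnalyticAt.comp (g := fun x => T x - T (x₀ + ‖x - x₀‖ • e₀))
      (f := fun x : E3 => x₀ + ‖x - x₀‖ • (τ • e₁)) hB hC
    have hsum' := hA.add hBC
    refine hsum'.congr (Eventually.of_forall fun x => ?_)
    simp only [Pi.add_apply, comp_apply, add_sub_cancel_left, norm_smul, norm_norm, hσ₁, mul_one]
    ring
  · -- the tangential gradient is unchanged
    intro x hx
    have hy : x - x₀ ≠ 0 := sub_ne_zero.2 hx
    have hpos : 0 < ‖x - x₀‖ ^ 2 := by positivity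
    have hTx : DifferentiableAt ℝ T x :=
      (hT1.differentiableOn one_ne_zero).differentiableAt (isOpen_compl_singleton.mem_nhds hx)
    -- differentiability of `u ↦ T (x₀ + √u • e₀)` at `u = ‖x − x₀‖² > 0`
    have hq : x₀ + Real.sqrt (‖x - x₀‖ ^ 2) • e₀ ≠ x₀ := by
      rw [Real.sqrt_sq (norm_nonneg _)]
      intro h
      have h2 : ‖x - x₀‖ • e₀ = 0 := by simpa using h
      rcases smul_eq_zero.1 h2 with h3 | h3
      · exact hy (norm_eq_zero.1 h3)
      · exact (one_ne_zero (α := ℝ)) (by simpa [he₀] using congrArg (fun w : E3 => w 0) h3)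
    have hT2 : DifferentiableAt ℝ T (x₀ + Real.sqrt (‖x - x₀‖ ^ 2) • e₀) :=
      (hT1.differentiableOn one_ne_zero).differentiableAt (isOpen_compl_singleton.mem_nhds hq)
    have hin : DifferentiableAt ℝ (fun u : ℝ => x₀ + Real.sqrt u • e₀) (‖x - x₀‖ ^ 2) :=
      ((Real.hasDerivAt_sqrt hpos.ne').differentiableAt.smul_const e₀).const_add x₀
    have hcd : DifferentiableAt ℝ (fun u : ℝ => T (x₀ + Real.sqrt u • e₀)) (‖x - x₀‖ ^ 2) :=
      hT2.comp (‖x - x₀‖ ^ 2) hin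
    -- the radial summand is a function of `‖x − x₀‖²`
    have key := cross_gradient_sub_radial (f := T) (c := fun u : ℝ => T (x₀ + Real.sqrt u • e₀))
      (x₀ := x₀) (x := x) hTx hcd
    simpa only [Real.sqrt_sq_eq_abs, abs_norm] using key

end AnalyticNormalisation

end Summit.NavierStokesRegularity.NavierStokesRegularity.Theorems.PoloidalLiouville.NetFlux
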